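import Summits.QuantumAdvantage.QuantumAdvantage.Theorems.LinnikCubicClassGroupsDegreeOnePrimesEscapeOdlyzkoDiscriminantBoundSharp
import Mathlib.NumberTheory.ZetaValues
import HarnessLib

/-!
# Odlyzko's bound with three differences: the digamma numerics (gains `≥ 0.942` and `≥ 0.652`)

Topic `Summits/QuantumAdvantage/QuantumAdvantage/Theorems`, helper file for the crux
`DegreeOnePrimesEscape` (stmt-QuantumAdvantage-11543, closed) of route `LinnikCubicClassGroups`;
cell B2b-1 (linnik-cubic), PART A. HONEST FRAMING: the value of this file is a THEOREM (kernel-checked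
numerics) — NOT summit progress.

For the seven-point family `c = (183/100; 39/10, −57/10; 2107/100, −527/25; 847/100, −749/100)`,
`τ = (σ; 31/25, 129/100; 8/5, 33/20; 27/10, 11/4)` of `…OdlyzkoDiscriminantBoundSharp`
(`Σ_{i≥1} c_i = −83/100`), the gains over Stark's constants are

  `G_ℝ = −Σ_{i≥1} c_i (ψ(τ_i/2) − ψ(½))`, `G_ℂ = −Σ_{i≥1} c_i (ψ(τ_i) − ψ(1))`

(true values `0.9441…`, `0.6565…`).  This file bounds them from below by `0.942` and `0.652`
(`sharp_gain_real`, `sharp_gain_complex`) using the series `ψ(x) − ψ(x₀) = Σ_k (x−x₀)/((x₀+k)(x+k))`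
with telescoping tail bounds from both sides (`re_digamma_sub_ge` of the companion file and
`re_digamma_sub_le` here).  Hence the asymptotic constants `4πe^{γ+0.942} ≈ 57.4` per real place and
`2πe^{γ+0.652} ≈ 21.48` per complex pair (numerics in `…SharpNumeric`).  Also recorded here: the
tangent-line inputs `ψ((1+h)/2) ≤ ψ(½) + (π²/4)h`, `ψ(1+h) ≤ ψ(1) + (π²/6)h`, `ψ(½) = −γ − 2log 2`,
`ψ(1) = −γ` used by the companion file.

## References

* A. M. Odlyzko, *Lower bounds for discriminants of number fields. II*, Tôhoku Math. J. 29 (1977)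
  209–216. [Odlyzko1977]
* G. E. Andrews, R. Askey, R. Roy, *Special Functions* (1999), Thm 1.2.5. [AndrewsAskeyRoy1999]
-/

noncomputable section

open scoped NumberField
open Complex Filter Topology Set NumberField

namespace Summit.QuantumAdvantage.QuantumAdvantage.Theorems.DegreeOnePrimesEscape

namespace OdlyzkoSharp

open Literature.NumberTheory.LFunctions Literature.NumberTheory.LFunctions.NumberField OdlyzkoBound

/-! ### An upper bound for differences of the digamma function on the real axis -/

/-- The telescoping series `Σ_k (1/(c+k) − 1/(c+k+1)) = 1/c` for `c > 0`. [folklore] -/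
private theorem hasSum_inv_sub_inv_succ {c : ℝ} (hc : 0 < c) :
    HasSum (fun k : ℕ ↦ 1 / (c + k) - 1 / (c + k + 1)) (1 / c) := by
  have hnn : ∀ k : ℕ, 0 ≤ 1 / (c + k) - 1 / (c + k + 1) := fun k ↦ by
    rw [sub_nonneg]
    exact one_div_le_one_div_of_le (by positivity) (by linarith)
  refine (hasSum_iff_tendsto_nat_of_nonneg hnn _).2 ?_
  have hpartial : ∀ n : ℕ, ∑ k ∈ Finset.range n, (1 / (c + k) - 1 / (c + k + 1)) =
      1 / c - 1 / (c + n) := by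
    intro n
    induction n with
    | zero => simp
    | succ n ih =>
      rw [Finset.sum_range_succ, ih]
      push_cast
      ring
  simp_rw [hpartial]
  have h0 : Tendsto (fun n : ℕ ↦ 1 / (c + (n : ℝ))) atTop (𝓝 0) :=
    tendsto_const_nhds.div_atTop (tendsto_atTop_add_const_left _ _ tendsto_natCast_atTop_atTop)
  simpa using tendsto_const_nhds.sub h0

/-- **Upper bound for `ψ(x) − ψ(x₀)` on the real axis**: for `0 < x₀ ≤ x` and `N ≥ 1`,
`ψ(x) − ψ(x₀) ≤ (x − x₀)(Σ_{k<N} 1/((x₀+k)(x+k)) + 1/(x₀+N−1))` (the tail of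
`Σ_k (x−x₀)/((x₀+k)(x+k))` is at most the telescoping `(x−x₀)Σ_{k≥N}(1/(x₀+k−1) − 1/(x₀+k))`
because `(x₀+k)(x+k) ≥ (x₀+k−1)(x₀+k)`). [cite: AndrewsAskeyRoy1999, Thm 1.2.5 (1.2.13)] -/
theorem re_digamma_sub_le {x₀ x : ℝ} (hx₀ : 0 < x₀) (hx : x₀ ≤ x) {N : ℕ} (hN : 1 ≤ N) :
    (digamma (x : ℂ)).re - (digamma (x₀ : ℂ)).re ≤
      (x - x₀) * (∑ k ∈ Finset.range N, 1 / ((x₀ + k) * (x + k)) + 1 / (x₀ + N - 1)) := by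
  have hxpos : 0 < x := lt_of_lt_of_le hx₀ hx
  have hN1 : (1 : ℝ) ≤ N := by exact_mod_cast hN
  have h₀ := hasSum_re_digamma_ofReal hx₀
  have h₁ := hasSum_re_digamma_ofReal hxpos
  set f : ℕ → ℝ := fun k ↦ 1 / (x₀ + k) - 1 / (x + k) with hf
  have hdiff : HasSum f ((digamma (x : ℂ)).re + Real.eulerMascheroniConstant -
      ((digamma (x₀ : ℂ)).re + Real.eulerMascheroniConstant)) := by
    refine (h₁.sub h₀).congr_fun fun k ↦ ?_
    simp only [hf]
    ring
  have hfsum : Summable f := hdiff.summable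
  have hfin : ∑ k ∈ Finset.range N, f k =
      (x - x₀) * ∑ k ∈ Finset.range N, 1 / ((x₀ + k) * (x + k)) := by
    rw [Finset.mul_sum]
    refine Finset.sum_congr rfl fun k _ ↦ ?_
    have ha : (0 : ℝ) < x₀ + k := by positivity
    have hb : (0 : ℝ) < x + k := by positivity
    simp only [hf]
    field_simp
    ring
  have htele := hasSum_inv_sub_inv_succ (c := x₀ + N - 1) (by linarith)
  have htail_le : ∀ k : ℕ, f (k + N) ≤ (x - x₀) * (1 / (x₀ + N - 1 + k) - 1 / (x₀ + N - 1 + k + 1)) := by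
    intro k
    have ha : (0 : ℝ) < x₀ + (k + N : ℕ) := by positivity
    have hb : (0 : ℝ) < x + (k + N : ℕ) := by positivity
    have hc : (0 : ℝ) < x₀ + N - 1 + k := by linarith
    have hd : (0 : ℝ) < x₀ + N - 1 + k + 1 := by linarith
    have e1 : f (k + N) = (x - x₀) / ((x₀ + (k + N : ℕ)) * (x + (k + N : ℕ))) := by
      simp only [hf]
      field_simp
      ring
    have e2 : (x - x₀) * (1 / (x₀ + N - 1 + k) - 1 / (x₀ + N - 1 + k + 1)) =
        (x - x₀) / ((x₀ + N - 1 + k) * (x₀ + N - 1 + k + 1)) := by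
      field_simp
      ring
    rw [e1, e2]
    refine div_le_div_of_nonneg_left (by linarith) (mul_pos hc hd) ?_
    have h1 : x₀ + N - 1 + k ≤ x₀ + (k + N : ℕ) := by push_cast; linarith
    have h2 : x₀ + N - 1 + k + 1 ≤ x + (k + N : ℕ) := by push_cast; linarith
    exact mul_le_mul h1 h2 hd.le ha.le
  have htail : ∑' k, f (k + N) ≤ (x - x₀) * (1 / (x₀ + N - 1)) :=
    hasSum_le htail_le ((summable_nat_add_iff N).2 hfsum).hasSum (htele.mul_left _)
  have hsplit := hfsum.sum_add_tsum_nat_add N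
  rw [hdiff.tsum_eq] at hsplit
  rw [mul_add, ← hfin]
  linarith

/-! ### The twelve digamma differences -/

/-- `lower bound: ψ(31 / 50) − ψ(1 / 2)` ≥ `0.493522` (20 terms of the series
and the telescoping tail). [folklore] -/
theorem dR1 : (0.493522 : ℝ) ≤ (digamma ((31 / 50 : ℝ) : ℂ)).re - (digamma ((1 / 2 : ℝ) : ℂ)).re := by
  have h := re_digamma_sub_ge (x₀ := 1 / 2) (x := 31 / 50) (by norm_num) (by norm_num) 20
  have hS : (0.493522 : ℝ) ≤ (31 / 50 - 1 / 2 : ℝ) *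
      (∑ k ∈ Finset.range 20, 1 / ((1 / 2 + (k : ℝ)) * (31 / 50 + (k : ℝ))) + 1 / (31 / 50 + ((20 : ℕ) : ℝ))) := by
    simp only [Finset.sum_range_succ, Finset.sum_range_zero]
    norm_num
  linarith

/-- `lower bound: ψ(129 / 200) − ψ(31 / 50)` ≥ `0.083389` (20 terms of the series
and the telescoping tail). [folklore] -/
theorem dR21 : (0.083389 : ℝ) ≤ (digamma ((129 / 200 : ℝ) : ℂ)).re - (digamma ((31 / 50 : ℝ) : ℂ)).re := by
  have h := re_digamma_sub_ge (x₀ := 31 / 50) (x := 129 / 200) (by norm_num) (by norm_num) 20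
  have hS : (0.083389 : ℝ) ≤ (129 / 200 - 31 / 50 : ℝ) *
      (∑ k ∈ Finset.range 20, 1 / ((31 / 50 + (k : ℝ)) * (129 / 200 + (k : ℝ))) + 1 / (129 / 200 + ((20 : ℕ) : ℝ))) := by
    simp only [Finset.sum_range_succ, Finset.sum_range_zero]
    norm_num
  linarith

/-- `lower bound: ψ(4 / 5) − ψ(1 / 2)` ≥ `0.998038` (20 terms of the series
and the telescoping tail). [folklore] -/
theorem dR3 : (0.998038 : ℝ) ≤ (digamma ((4 / 5 : ℝ) : ℂ)).re - (digamma ((1 / 2 : ℝ) : ℂ)).re := by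
  have h := re_digamma_sub_ge (x₀ := 1 / 2) (x := 4 / 5) (by norm_num) (by norm_num) 20
  have hS : (0.998038 : ℝ) ≤ (4 / 5 - 1 / 2 : ℝ) *
      (∑ k ∈ Finset.range 20, 1 / ((1 / 2 + (k : ℝ)) * (4 / 5 + (k : ℝ))) + 1 / (4 / 5 + ((20 : ℕ) : ℝ))) := by
    simp only [Finset.sum_range_succ, Finset.sum_range_zero]
    norm_num
  linarith

/-- `lower bound: ψ(33 / 40) − ψ(4 / 5)` ≥ `0.056111` (20 terms of the series
and the telescoping tail). [folklore] -/
theorem dR43 : (0.056111 : ℝ) ≤ (digamma ((33 / 40 : ℝ) : ℂ)).re - (digamma ((4 / 5 : ℝ) : ℂ)).re := by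
  have h := re_digamma_sub_ge (x₀ := 4 / 5) (x := 33 / 40) (by norm_num) (by norm_num) 20
  have hS : (0.056111 : ℝ) ≤ (33 / 40 - 4 / 5 : ℝ) *
      (∑ k ∈ Finset.range 20, 1 / ((4 / 5 + (k : ℝ)) * (33 / 40 + (k : ℝ))) + 1 / (33 / 40 + ((20 : ℕ) : ℝ))) := by
    simp only [Finset.sum_range_succ, Finset.sum_range_zero]
    norm_num
  linarith

/-- `upper bound: ψ(27 / 20) − ψ(1 / 2)` ≤ `1.850075` (40 terms of the series
and the telescoping tail). [folklore] -/
theorem dR5 : (digamma ((27 / 20 : ℝ) : ℂ)).re - (digamma ((1 / 2 : ℝ) : ℂ)).re ≤ (1.850075 : ℝ) := by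
  have h := re_digamma_sub_le (x₀ := 1 / 2) (x := 27 / 20) (by norm_num) (by norm_num) (N := 40) (by norm_num)
  have hS : (27 / 20 - 1 / 2 : ℝ) *
      (∑ k ∈ Finset.range 40, 1 / ((1 / 2 + (k : ℝ)) * (27 / 20 + (k : ℝ))) + 1 / (1 / 2 + ((40 : ℕ) : ℝ) - 1)) ≤
      (1.850075 : ℝ) := by
    simp only [Finset.sum_range_succ, Finset.sum_range_zero]
    norm_num
  linarith

/-- `lower bound: ψ(11 / 8) − ψ(27 / 20)` ≥ `0.026567` (20 terms of the series
and the telescoping tail). [folklore] -/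
theorem dR65 : (0.026567 : ℝ) ≤ (digamma ((11 / 8 : ℝ) : ℂ)).re - (digamma ((27 / 20 : ℝ) : ℂ)).re := by
  have h := re_digamma_sub_ge (x₀ := 27 / 20) (x := 11 / 8) (by norm_num) (by norm_num) 20
  have hS : (0.026567 : ℝ) ≤ (11 / 8 - 27 / 20 : ℝ) *
      (∑ k ∈ Finset.range 20, 1 / ((27 / 20 + (k : ℝ)) * (11 / 8 + (k : ℝ))) + 1 / (11 / 8 + ((20 : ℕ) : ℝ))) := by
    simp only [Finset.sum_range_succ, Finset.sum_range_zero]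
    norm_num
  linarith

/-- `lower bound: ψ(31 / 25) − ψ(1)` ≥ `0.337384` (20 terms of the series
and the telescoping tail). [folklore] -/
theorem dC1 : (0.337384 : ℝ) ≤ (digamma ((31 / 25 : ℝ) : ℂ)).re - (digamma ((1 : ℝ) : ℂ)).re := by
  have h := re_digamma_sub_ge (x₀ := 1) (x := 31 / 25) (by norm_num) (by norm_num) 20
  have hS : (0.337384 : ℝ) ≤ (31 / 25 - 1 : ℝ) *
      (∑ k ∈ Finset.range 20, 1 / ((1 + (k : ℝ)) * (31 / 25 + (k : ℝ))) + 1 / (31 / 25 + ((20 : ℕ) : ℝ))) := by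
    simp only [Finset.sum_range_succ, Finset.sum_range_zero]
    norm_num
  linarith

/-- `lower bound: ψ(129 / 100) − ψ(31 / 25)` ≥ `0.058841` (20 terms of the series
and the telescoping tail). [folklore] -/
theorem dC21 : (0.058841 : ℝ) ≤ (digamma ((129 / 100 : ℝ) : ℂ)).re - (digamma ((31 / 25 : ℝ) : ℂ)).re := by
  have h := re_digamma_sub_ge (x₀ := 31 / 25) (x := 129 / 100) (by norm_num) (by norm_num) 20
  have hS : (0.058841 : ℝ) ≤ (129 / 100 - 31 / 25 : ℝ) *
      (∑ k ∈ Finset.range 20, 1 / ((31 / 25 + (k : ℝ)) * (129 / 100 + (k : ℝ))) + 1 / (129 / 100 + ((20 : ℕ) : ℝ))) := by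
    simp only [Finset.sum_range_succ, Finset.sum_range_zero]
    norm_num
  linarith

/-- `lower bound: ψ(8 / 5) − ψ(1)` ≥ `0.702198` (20 terms of the series
and the telescoping tail). [folklore] -/
theorem dC3 : (0.702198 : ℝ) ≤ (digamma ((8 / 5 : ℝ) : ℂ)).re - (digamma ((1 : ℝ) : ℂ)).re := by
  have h := re_digamma_sub_ge (x₀ := 1) (x := 8 / 5) (by norm_num) (by norm_num) 20
  have hS : (0.702198 : ℝ) ≤ (8 / 5 - 1 : ℝ) *
      (∑ k ∈ Finset.range 20, 1 / ((1 + (k : ℝ)) * (8 / 5 + (k : ℝ))) + 1 / (8 / 5 + ((20 : ℕ) : ℝ))) := by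
    simp only [Finset.sum_range_succ, Finset.sum_range_zero]
    norm_num
  linarith

/-- `lower bound: ψ(33 / 20) − ψ(8 / 5)` ≥ `0.042007` (20 terms of the series
and the telescoping tail). [folklore] -/
theorem dC43 : (0.042007 : ℝ) ≤ (digamma ((33 / 20 : ℝ) : ℂ)).re - (digamma ((8 / 5 : ℝ) : ℂ)).re := by
  have h := re_digamma_sub_ge (x₀ := 8 / 5) (x := 33 / 20) (by norm_num) (by norm_num) 20
  have hS : (0.042007 : ℝ) ≤ (33 / 20 - 8 / 5 : ℝ) *
      (∑ k ∈ Finset.range 20, 1 / ((8 / 5 + (k : ℝ)) * (33 / 20 + (k : ℝ))) + 1 / (33 / 20 + ((20 : ℕ) : ℝ))) := by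
    simp only [Finset.sum_range_succ, Finset.sum_range_zero]
    norm_num
  linarith

/-- `upper bound: ψ(27 / 10) − ψ(1)` ≤ `1.375383` (40 terms of the series
and the telescoping tail). [folklore] -/
theorem dC5 : (digamma ((27 / 10 : ℝ) : ℂ)).re - (digamma ((1 : ℝ) : ℂ)).re ≤ (1.375383 : ℝ) := by
  have h := re_digamma_sub_le (x₀ := 1) (x := 27 / 10) (by norm_num) (by norm_num) (N := 40) (by norm_num)
  have hS : (27 / 10 - 1 : ℝ) *
      (∑ k ∈ Finset.range 40, 1 / ((1 + (k : ℝ)) * (27 / 10 + (k : ℝ))) + 1 / (1 + ((40 : ℕ) : ℝ) - 1)) ≤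
      (1.375383 : ℝ) := by
    simp only [Finset.sum_range_succ, Finset.sum_range_zero]
    norm_num
  linarith

/-- `lower bound: ψ(11 / 4) − ψ(27 / 10)` ≥ `0.022066` (20 terms of the series
and the telescoping tail). [folklore] -/
theorem dC65 : (0.022066 : ℝ) ≤ (digamma ((11 / 4 : ℝ) : ℂ)).re - (digamma ((27 / 10 : ℝ) : ℂ)).re := by
  have h := re_digamma_sub_ge (x₀ := 27 / 10) (x := 11 / 4) (by norm_num) (by norm_num) 20
  have hS : (0.022066 : ℝ) ≤ (11 / 4 - 27 / 10 : ℝ) *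
      (∑ k ∈ Finset.range 20, 1 / ((27 / 10 + (k : ℝ)) * (11 / 4 + (k : ℝ))) + 1 / (11 / 4 + ((20 : ℕ) : ℝ))) := by
    simp only [Finset.sum_range_succ, Finset.sum_range_zero]
    norm_num
  linarith

/-! ### The gains -/

/-- **`G_ℝ ≥ 0.942`**: `−Σ_{i≥1} c_i ψ(τ_i/2) − (83/100) ψ(½) ≥ 0.942` (`Σ_{i≥1} c_i = −83/100`; Abel
regrouping into the six differences above; true value `0.9441…`). [folklore] -/
theorem sharp_gain_real :
    (0.942 : ℝ) ≤ -(39 / 10 * (digamma ((31 / 50 : ℝ) : ℂ)).re - 57 / 10 * (digamma ((129 / 200 : ℝ) : ℂ)).re + 2107 / 100 * (digamma ((4 / 5 : ℝ) : ℂ)).re - 527 / 25 * (digamma ((33 / 40 : ℝ) : ℂ)).re + 847 / 100 * (digamma ((27 / 20 : ℝ) : ℂ)).re - 749 / 100 * (digamma ((11 / 8 : ℝ) : ℂ)).re) -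
      83 / 100 * (digamma ((1 / 2 : ℝ) : ℂ)).re := by
  have h1 := dR1; have h2 := dR21; have h3 := dR3; have h4 := dR43; have h5 := dR5; have h6 := dR65
  linarith

/-- **`G_ℂ ≥ 0.652`**: `−Σ_{i≥1} c_i ψ(τ_i) − (83/100) ψ(1) ≥ 0.652` (true value `0.6565…`). [folklore] -/
theorem sharp_gain_complex :
    (0.652 : ℝ) ≤ -(39 / 10 * (digamma ((31 / 25 : ℝ) : ℂ)).re - 57 / 10 * (digamma ((129 / 100 : ℝ) : ℂ)).re + 2107 / 100 * (digamma ((8 / 5 : ℝ) : ℂ)).re - 527 / 25 * (digamma ((33 / 20 : ℝ) : ℂ)).re + 847 / 100 * (digamma ((27 / 10 : ℝ) : ℂ)).re - 749 / 100 * (digamma ((11 / 4 : ℝ) : ℂ)).re) -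
      83 / 100 * (digamma ((1 : ℝ) : ℂ)).re := by
  have h1 := dC1; have h2 := dC21; have h3 := dC3; have h4 := dC43; have h5 := dC5; have h6 := dC65
  linarith

/-! ### Tangent-line inputs for `ψ` at `1/2` and `1` -/

/-- `Σ_{k ≥ 0} (k+1)^{−2} = π²/6`. [folklore] -/
theorem hasSum_inv_nat_add_one_sq :
    HasSum (fun k : ℕ ↦ 1 / ((k : ℝ) + 1) ^ 2) (Real.pi ^ 2 / 6) := by
  have h := (hasSum_nat_add_iff' (f := fun n : ℕ ↦ (1 : ℝ) / (n : ℝ) ^ 2) 1).mpr hasSum_zeta_two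
  simp only [Finset.sum_range_one, Nat.cast_zero, ne_eq, OfNat.ofNat_ne_zero, not_false_eq_true,
    zero_pow, div_zero, sub_zero, Nat.cast_add, Nat.cast_one] at h
  exact h

/-- `Σ_{k ≥ 0} (k+½)^{−2} = π²/2`. [folklore] -/
theorem hasSum_inv_nat_add_half_sq :
    HasSum (fun k : ℕ ↦ 1 / ((k : ℝ) + 1 / 2) ^ 2) (Real.pi ^ 2 / 2) := by
  set f : ℕ → ℝ := fun n ↦ 1 / (n : ℝ) ^ 2 with hf
  have h : HasSum f (Real.pi ^ 2 / 6) := hasSum_zeta_two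
  have he : HasSum (fun k : ℕ ↦ f (2 * k)) (Real.pi ^ 2 / 24) := by
    rw [show Real.pi ^ 2 / 24 = 1 / 4 * (Real.pi ^ 2 / 6) by ring]
    exact (h.mul_left (1 / 4)).congr_fun fun k ↦ by simp only [hf]; push_cast; ring
  have hinj : Function.Injective (fun k : ℕ ↦ 2 * k + 1) := fun a b hab ↦ by simpa using hab
  obtain ⟨x, hx⟩ := h.summable.comp_injective hinj
  have hx' : HasSum (fun k : ℕ ↦ f (2 * k + 1)) x := hx
  have htot : HasSum f (Real.pi ^ 2 / 24 + x) := he.even_add_odd hx'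
  have hxval : x = Real.pi ^ 2 / 8 := by
    have := htot.unique h
    linarith
  rw [show Real.pi ^ 2 / 2 = 4 * x by rw [hxval]; ring]
  refine (hx'.mul_left 4).congr_fun fun k ↦ ?_
  simp only [hf]
  have hk : (2 * (k : ℝ) + 1) ≠ 0 := by positivity
  have hk' : ((k : ℝ) + 1 / 2) ≠ 0 := by positivity
  push_cast
  field_simp
  ring

/-- `ψ(½) = −γ − 2 log 2` on the real axis. [folklore] -/
theorem re_digamma_half :
    (digamma (((1 / 2 : ℝ)) : ℂ)).re = -Real.eulerMascheroniConstant - 2 * Real.log 2 := by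
  have e : digamma (((1 / 2 : ℝ)) : ℂ) =
      (((-2 * Real.log 2 - Real.eulerMascheroniConstant : ℝ)) : ℂ) := by
    rw [show (((1 / 2 : ℝ)) : ℂ) = 1 / 2 by push_cast; ring, Complex.digamma_one_half]
    push_cast
    simp only [Complex.ofNat_log]
  rw [e, ofReal_re]
  ring

/-- `ψ((1+h)/2) ≤ −γ − 2 log 2 + (π²/4) h` for `h ≥ 0`. [folklore] -/
theorem re_digamma_half_add_le {h : ℝ} (hh : 0 ≤ h) :
    (digamma ((((1 + h) / 2 : ℝ)) : ℂ)).re ≤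
      -Real.eulerMascheroniConstant - 2 * Real.log 2 + Real.pi ^ 2 / 4 * h := by
  have h1 := re_digamma_ofReal_sub_le (x₀ := 1 / 2) (x := (1 + h) / 2) (by norm_num) (by linarith)
    hasSum_inv_nat_add_half_sq
  rw [re_digamma_half] at h1
  nlinarith [Real.pi_pos]

/-- `ψ(1+h) ≤ −γ + (π²/6) h` for `h ≥ 0`. [folklore] -/
theorem re_digamma_one_add_le {h : ℝ} (hh : 0 ≤ h) :
    (digamma (((1 + h : ℝ)) : ℂ)).re ≤ -Real.eulerMascheroniConstant + Real.pi ^ 2 / 6 * h := by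
  have h1 := re_digamma_ofReal_sub_le (x₀ := 1) (x := 1 + h) one_pos (by linarith)
    hasSum_inv_nat_add_one_sq
  have hone : (digamma (((1 : ℝ)) : ℂ)).re = -Real.eulerMascheroniConstant := by
    rw [ofReal_one, Complex.digamma_one]
    simp
  rw [hone] at h1
  nlinarith [Real.pi_pos]

/-- `ψ(1) = −γ` on the real axis. [folklore] -/
theorem re_digamma_one : (digamma (((1 : ℝ)) : ℂ)).re = -Real.eulerMascheroniConstant := by
  rw [ofReal_one, Complex.digamma_one]
  simp


end OdlyzkoSharp

end Summit.QuantumAdvantage.QuantumAdvantage.Theorems.DegreeOnePrimesEscape
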